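import Summits.QuantumFields.BalabanUV.Beta.FP.NestedStepLawTransportedGraded
import Summits.QuantumFields.BalabanUV.Beta.FP.ExponentialTransportJets

/-!
# `BalabanUV.Beta.FP.NestedStepLawTransportedExpGraded` — road «FP» for binder row D1, ROUTE T, presentation T-β, option (δ) «LIFT ∕ GRADED» (R-FP-54′):
# **THE GRADED TRANSPORTED ONE-SHOT STEP LAW FOR A ONE-PARAMETER-GROUP TRANSPORT** (`NestedStepLawTransportedGraded` §2 at the exponential 2-jets of
# leaf-06's `ExponentialTransportJets`; the colour lift `cgen` is a PROOF DEVICE here, not a hypothesis)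

WHAT.  The graded twin of `NestedStepLawTransportedExp` (p319988).  `NestedStepLawTransportedGraded.secondVar_oneShot_nestedStepLaw_transported_graded_of_uni`
displays an antisymmetric colour matrix `c` (`cᵀ = −c`, `tr(c·c) ≠ 0`), general transport 2-jets `A A′ Ā` with the letters `uA uĀ i0 i1 i2 hA hĀ`, and a general
parameter transport `C` with `hC`.  Here `c := cgen` (`D1BFx.ColourLift`: `cgenᵀ = −cgen`, `tr(cgen·cgen) = −2`) is fixed INSIDE the proof — the conclusion
never mentions it — and the chart transport is a ONE-PARAMETER GROUP to second order: fields `exp(uX)` (inverse `exp(−uX)`), composite multipliers `exp(uX̄)`,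
parameters `C = (1, C₁, C₂)`, so that `hA hĀ i* uA uĀ hC` are DISCHARGED BY NAME by leaf-06's `ExponentialTransportJets` (`det_expJet₀_ne_zero`, `expJet_b0∕b1∕b2`,
`secondVar_expJet`) and the unit jets are erased from the displayed letters.  What remains displayed: the door's GRADED namings `h𝔎ₙ h𝔔ₙ`, the GRADED
conjugated words **`k1 : −(Xᵀ𝔎₀) + 𝔎₁ + 𝔎₀X = 𝔎′₁`** (for a DIAGONAL torus gauge generator, `Xᵀ = X`, this is the COMMUTATOR word `𝔎′₁ = 𝔎₁ + (𝔎₀X − X𝔎₀)` of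
`PeriodisedFormIndexWard(Doubled)`), **`k2`** (the four words led by `Xᵀ` negative), `q1 q2` (one-sided, as p319988), the intertwining `j1 j2` and `uC` (as p319988),
the parities `𝔎₀ᵀ = 𝔎₀ ∕ 𝔎₁ᵀ = −𝔎₁ ∕ 𝔎₂ᵀ = 𝔎₂`, the door's GRADED one-sided Ward letters `a0 a1 a2`, `b*`, `hPW hTW`, the block namings and (INV).  §1
`…_expTransported_graded_of_uni`: the two chart-native (UNI)-jet letters `uP' : secondVar (P·W₀) (P·W♯₁) (P·W♯₂) = 0` (one-shot chart — dead rows, forest, or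
leaf-06's `TorusOneShotFPExponential.torus_uP_exp`) and `uT` (nested chart); §2 `…_of_letters`: the six dead-row letters instead.  CONCLUSION (both): the
door's graded three-term law — odd bordered jets (−)-PLACED, coarse words `Bᵀ ↦ −Bᵀ` — with NO Faddeev–Popov defect.  [folklore] specialisation BY NAME;
no `def`, no `def … : Prop`, nothing cited, 0 sorry.  Nothing of the dictionary asserted.

HONEST DEPENDENCY (page 1, mandatory): continuum YM on T⁴ ⇐ BetaPertH ∧ nine spine estimates (0/9 proved); BetaPertH ⇐ (D1) ∧ (D4) ∧ CAP+tail;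
G-an2-4 gates asym, D1 and NE2/3/4.  HONEST FRAMING (cell contract, verbatim): «discharging `BetaPertH` makes Bałaban's UV stability UNCONDITIONAL —
a real constructive-QFT result; it is NOT the continuum limit and NOT the Clay problem.»  ABSOLUTE RULE (cell charter, verbatim): «No internally-minted
statement may enter as a cited fact. Every hypothesis is either kernel-proved in this package or a verbatim quotation of a PUBLISHED theorem with page
reference. The manuscript(s) under audit are NOT citable for their own disputed steps — they are the thing under adjudication; programme-internal
(2001/route/tribunal) claims are never citable.»  0 estimates; 0∕4 row-D1 binders; NOT (T-ID), NOT SDF, NOT D1, NOT BetaPertH, NOT continuum, NOT Clay.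
Road «FP» OWNER, b2b-balaban-beta-d1-p3 gen 19, 2026-08-22.  No existing file touched.
-/

noncomputable section

namespace Summit.QuantumFields.BalabanUV.Beta.FP.NestedStepLawTransportedExpGraded

open Matrix
open Literature.MathematicalPhysics.QuantumFieldTheory.Balaban1983to89.Beta.Composition (kkt)
open Literature.MathematicalPhysics.QuantumFieldTheory.Balaban1983to89.Beta.CompositionSingular (effForm flucCov minOp minOpL)
open Summit.QuantumFields.BalabanUV.Beta.D1BFx.LogDetSecondVariation (secondVar)
open Summit.QuantumFields.BalabanUV.Beta.D1BFx.ColourLift (cgen cgen_transpose trace_cgen_mul_cgen)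
open Summit.QuantumFields.BalabanUV.Beta.FP.NestedStepLawTransported (secondVar_nestedFP_eq_zero)
open Summit.QuantumFields.BalabanUV.Beta.FP.NestedStepLawTransportedGraded (secondVar_oneShot_nestedStepLaw_transported_graded_of_uni)
open Summit.QuantumFields.BalabanUV.Beta.FP.ExponentialTransportJets (expJet_b0 expJet_b1 expJet_b2 secondVar_expJet det_expJet₀_ne_zero)
open Summit.QuantumFields.BalabanUV.Beta.FP.CombSliceJetLetters (secondVar_zero_jets)

variable {ν μ κ ρ₁ ρ₂ : Type*} [Fintype ν] [Fintype μ] [Fintype κ] [Fintype ρ₁] [Fintype ρ₂]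
  [DecidableEq ν] [DecidableEq μ] [DecidableEq κ] [DecidableEq ρ₁] [DecidableEq ρ₂]

/-! ## §1 Under the two chart-native (UNI)-jet letters -/

/-- [folklore] **THE GRADED ONE-SHOT-SLICED COMPOSITE STEP LAW, TRANSPORT FIRST, FOR A ONE-PARAMETER-GROUP TRANSPORT, UNDER THE (UNI)-JET LETTERS: ZERO
DEFECT.**  Data and GRADED letters of the door `secondVar_oneShot_nestedStepLaw_jets_graded` (p323821) in the NESTED chart; transport generators `X` (fields),
`X̄` (composite multipliers); the one-shot literal's composite jets `𝔎♯₁ 𝔎♯₂ 𝔔♯₁ 𝔔♯₂` NAMED as the GRADED `X`-conjugated words; the one-shot chart's generator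
jets `W♯₁ W♯₂` and parameter-transport jets `C₁ C₂` with `j1 j2`, `secondVar 1 C₁ C₂ = 0`; the (UNI)-jet letters `uP' uT`.  CONCLUSION: the door's graded
three-term law, no defect. -/
theorem secondVar_oneShot_nestedStepLaw_expTransported_graded_of_uni
    (H₀ H₁ H₂ : Matrix ν ν ℝ) (Q₁₀ Q₁₁ Q₁₂ : Matrix μ ν ℝ) (Q₂₀ Q₂₁ Q₂₂ : Matrix κ μ ℝ) (G₀ G₁ G₂ : Matrix μ μ ℝ)
    (τ₁ : Matrix ρ₁ ν ℝ) (τ₂ : Matrix ρ₂ μ ℝ) (P : Matrix (ρ₂ ⊕ ρ₁) ν ℝ) (W₀ W₁ W₂ : Matrix ν (ρ₂ ⊕ ρ₁) ℝ) (Y₀ Y₁ Y₂ : Matrix κ (ρ₂ ⊕ ρ₁) ℝ)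
    -- the transport generators (fields, composite multipliers), the one-shot chart's generator jets and the parameter-transport jets
    (X : Matrix ν ν ℝ) (Xbar : Matrix κ κ ℝ) (W'₁ W'₂ : Matrix ν (ρ₂ ⊕ ρ₁) ℝ) (C₁ C₂ : Matrix (ρ₂ ⊕ ρ₁) (ρ₂ ⊕ ρ₁) ℝ)
    {𝔎₀ 𝔎₁ 𝔎₂ : Matrix ν ν ℝ} {𝔔₀ 𝔔₁ 𝔔₂ : Matrix κ ν ℝ}
    -- GRADED namings of the composite jets of the NESTED chart (as the door p323821)
    (h𝔎₀ : H₀ + Q₁₀ᵀ * G₀ * Q₁₀ = 𝔎₀) (h𝔎₁ : H₁ + (-(Q₁₁ᵀ * G₀ * Q₁₀) + Q₁₀ᵀ * G₁ * Q₁₀ + Q₁₀ᵀ * G₀ * Q₁₁) = 𝔎₁)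
    (h𝔎₂ : H₂ + ((Q₁₂ᵀ * G₀ * Q₁₀ + -(Q₁₁ᵀ * G₁ * Q₁₀) + -(Q₁₁ᵀ * G₀ * Q₁₁)) + (-(Q₁₁ᵀ * G₁ * Q₁₀) + Q₁₀ᵀ * G₂ * Q₁₀ + Q₁₀ᵀ * G₁ * Q₁₁)
            + (-(Q₁₁ᵀ * G₀ * Q₁₁) + Q₁₀ᵀ * G₁ * Q₁₁ + Q₁₀ᵀ * G₀ * Q₁₂)) = 𝔎₂)
    (h𝔔₀ : Q₂₀ * Q₁₀ = 𝔔₀) (h𝔔₁ : Q₂₁ * Q₁₀ + Q₂₀ * Q₁₁ = 𝔔₁) (h𝔔₂ : Q₂₂ * Q₁₀ + Q₂₁ * Q₁₁ + (Q₂₁ * Q₁₁ + Q₂₀ * Q₁₂) = 𝔔₂)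
    -- (T-β-1) GRADED, exponential transport: the one-shot literal's composite jets are the graded `X`-conjugated words, NAMED (words led by `Xᵀ` negative)
    {𝔎'₁ 𝔎'₂ : Matrix ν ν ℝ} {𝔔'₁ 𝔔'₂ : Matrix κ ν ℝ}
    (k1 : -(Xᵀ * 𝔎₀) + 𝔎₁ + 𝔎₀ * X = 𝔎'₁)
    (k2 : (X * X)ᵀ * 𝔎₀ + (-(Xᵀ * 𝔎₁) + -(Xᵀ * 𝔎₀ * X)) + ((-(Xᵀ * 𝔎₁) + -(Xᵀ * 𝔎₀ * X)) + (𝔎₂ + 𝔎₁ * X + (𝔎₁ * X + 𝔎₀ * (X * X)))) = 𝔎'₂)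
    (q1 : Xbar * 𝔔₀ + 𝔔₁ + 𝔔₀ * X = 𝔔'₁)
    (q2 : Xbar * Xbar * 𝔔₀ + (Xbar * 𝔔₁ + Xbar * 𝔔₀ * X) + ((Xbar * 𝔔₁ + Xbar * 𝔔₀ * X) + (𝔔₂ + 𝔔₁ * X + (𝔔₁ * X + 𝔔₀ * (X * X)))) = 𝔔'₂)
    -- (T-β-4) intertwining (inverse field transport `(1, −X, X·X)`; `W♯₀ = W₀`, `C₀ = 1`) and unimodularity of the parameter transport
    (j1 : -X * W₀ + W₁ = W'₁ + W₀ * C₁) (j2 : X * X * W₀ + (2 : ℝ) • (-X * W₁) + W₂ = W'₂ + (2 : ℝ) • (W'₁ * C₁) + W₀ * C₂)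
    (uC : secondVar (1 : Matrix (ρ₂ ⊕ ρ₁) (ρ₂ ⊕ ρ₁) ℝ) C₁ C₂ = 0)
    -- the two chart-native (UNI)-jet letters
    (uP' : secondVar (P * W₀) (P * W'₁) (P * W'₂) = 0)
    (uT : secondVar (fromRows (τ₂ * Q₁₀) τ₁ * W₀) (fromRows (τ₂ * Q₁₁) (0 : Matrix ρ₁ ν ℝ) * W₀ + fromRows (τ₂ * Q₁₀) τ₁ * W₁)
      (fromRows (τ₂ * Q₁₂) (0 : Matrix ρ₁ ν ℝ) * W₀ + fromRows (τ₂ * Q₁₁) (0 : Matrix ρ₁ ν ℝ) * W₁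
        + (fromRows (τ₂ * Q₁₁) (0 : Matrix ρ₁ ν ℝ) * W₁ + fromRows (τ₂ * Q₁₀) τ₁ * W₂)) = 0)
    -- parities of the composite form jets of the nested chart (the two-sided letters follow)
    (h𝔎₀t : 𝔎₀ᵀ = 𝔎₀) (h𝔎₁t : 𝔎₁ᵀ = -𝔎₁) (h𝔎₂t : 𝔎₂ᵀ = 𝔎₂)
    -- GRADED one-sided Ward letters of the composite system, NESTED chart (as the door p323821)
    (a0 : 𝔎₀ * W₀ = 𝔔₀ᵀ * Y₀) (a1 : 𝔎₁ * W₀ + 𝔎₀ * W₁ = -(𝔔₁ᵀ * Y₀) + 𝔔₀ᵀ * Y₁)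
    (a2 : 𝔎₂ * W₀ + (2 : ℝ) • (𝔎₁ * W₁) + 𝔎₀ * W₂ = 𝔔₂ᵀ * Y₀ + -((2 : ℝ) • (𝔔₁ᵀ * Y₁)) + 𝔔₀ᵀ * Y₂)
    (b0 : 𝔔₀ * W₀ = 0) (b1 : 𝔔₁ * W₀ + 𝔔₀ * W₁ = 0) (b2 : 𝔔₂ * W₀ + (2 : ℝ) • (𝔔₁ * W₁) + 𝔔₀ * W₂ = 0)
    (hPW : (P * W₀).det ≠ 0) (hTW : (fromRows (τ₂ * Q₁₀) τ₁ * W₀).det ≠ 0)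
    {Γ : Matrix ν ν ℝ} {I : Matrix ν (μ ⊕ ρ₁) ℝ} {L : Matrix (μ ⊕ ρ₁) ν ℝ} {S : Matrix (μ ⊕ ρ₁) (μ ⊕ ρ₁) ℝ} {B : Matrix (μ ⊕ ρ₁) ν ℝ}
    (hΓ : flucCov H₀ (fromRows Q₁₀ τ₁) = Γ) (hI : minOp H₀ (fromRows Q₁₀ τ₁) = I) (hL : minOpL H₀ (fromRows Q₁₀ τ₁) = L) (hS : effForm H₀ (fromRows Q₁₀ τ₁) = S)
    (hB : fromRows Q₁₁ (0 : Matrix ρ₁ ν ℝ) = B)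
    (h1 : (kkt H₀ (fromRows Q₁₀ τ₁)).det ≠ 0)
    (h2 : (kkt (S.toBlocks₁₁ + G₀) (fromRows Q₂₀ τ₂)).det ≠ 0) :
    secondVar (kkt 𝔎₀ (fromRows 𝔔₀ P))
        (fromBlocks 𝔎'₁ (-(fromRows 𝔔'₁ (0 : Matrix (ρ₂ ⊕ ρ₁) ν ℝ))ᵀ) (fromRows 𝔔'₁ (0 : Matrix (ρ₂ ⊕ ρ₁) ν ℝ)) 0)
        (kkt 𝔎'₂ (fromRows 𝔔'₂ (0 : Matrix (ρ₂ ⊕ ρ₁) ν ℝ)))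
      = secondVar (kkt H₀ (fromRows Q₁₀ τ₁)) (fromBlocks H₁ (-Bᵀ) B 0) (kkt H₂ (fromRows Q₁₂ (0 : Matrix ρ₁ ν ℝ)))
        + secondVar
            (kkt (S.toBlocks₁₁ + G₀) (fromRows Q₂₀ τ₂))
            (fromBlocks (((L * H₁ - S * B) * I + L * Bᵀ * S).toBlocks₁₁ + G₁) (-(fromRows Q₂₁ (0 : Matrix ρ₂ μ ℝ))ᵀ)
              (fromRows Q₂₁ (0 : Matrix ρ₂ μ ℝ)) 0)
            (kkt ((((-((L * H₁ - S * B) * Γ - L * Bᵀ * L) * H₁ + L * H₂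
                      - (((L * H₁ - S * B) * I + L * Bᵀ * S) * B + S * fromRows Q₁₂ (0 : Matrix ρ₁ ν ℝ))) * I
                    + (L * H₁ - S * B) * (-((Γ * H₁ + I * B) * I + Γ * Bᵀ * S)))
                  - ((-((L * H₁ - S * B) * Γ - L * Bᵀ * L) * (-Bᵀ) + L * (fromRows Q₁₂ (0 : Matrix ρ₁ ν ℝ))ᵀ) * S
                      + L * (-Bᵀ) * ((L * H₁ - S * B) * I + L * Bᵀ * S))).toBlocks₁₁ + G₂)
              (fromRows Q₂₂ (0 : Matrix ρ₂ μ ℝ))) := by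
  -- the exponential jets: `A = (1, X, X·X)`, `A′ = (1, −X, X·X)`, `Ā = (1, X̄, X̄·X̄)`, `C = (1, C₁, C₂)`, `W♯₀ = W₀`; unit jets erased in the letters
  have k0 : (1 : Matrix ν ν ℝ)ᵀ * 𝔎₀ * (1 : Matrix ν ν ℝ) = 𝔎₀ := by rw [Matrix.transpose_one, Matrix.one_mul, Matrix.mul_one]
  have k1' : -(Xᵀ * 𝔎₀ * (1 : Matrix ν ν ℝ)) + (1 : Matrix ν ν ℝ)ᵀ * 𝔎₁ * (1 : Matrix ν ν ℝ) + (1 : Matrix ν ν ℝ)ᵀ * 𝔎₀ * X = 𝔎'₁ := by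
    simpa only [Matrix.transpose_one, Matrix.one_mul, Matrix.mul_one] using k1
  have k2' : (X * X)ᵀ * 𝔎₀ * (1 : Matrix ν ν ℝ) + (-(Xᵀ * 𝔎₁ * (1 : Matrix ν ν ℝ)) + -(Xᵀ * 𝔎₀ * X))
      + ((-(Xᵀ * 𝔎₁ * (1 : Matrix ν ν ℝ)) + -(Xᵀ * 𝔎₀ * X))
        + ((1 : Matrix ν ν ℝ)ᵀ * 𝔎₂ * (1 : Matrix ν ν ℝ) + (1 : Matrix ν ν ℝ)ᵀ * 𝔎₁ * X + ((1 : Matrix ν ν ℝ)ᵀ * 𝔎₁ * X + (1 : Matrix ν ν ℝ)ᵀ * 𝔎₀ * (X * X)))) = 𝔎'₂ := by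
    simpa only [Matrix.transpose_one, Matrix.one_mul, Matrix.mul_one] using k2
  have q0 : (1 : Matrix κ κ ℝ) * 𝔔₀ * (1 : Matrix ν ν ℝ) = 𝔔₀ := by rw [Matrix.one_mul, Matrix.mul_one]
  have q1' : Xbar * 𝔔₀ * (1 : Matrix ν ν ℝ) + (1 : Matrix κ κ ℝ) * 𝔔₁ * (1 : Matrix ν ν ℝ) + (1 : Matrix κ κ ℝ) * 𝔔₀ * X = 𝔔'₁ := by
    simpa only [Matrix.one_mul, Matrix.mul_one] using q1
  have q2' : Xbar * Xbar * 𝔔₀ * (1 : Matrix ν ν ℝ) + (Xbar * 𝔔₁ * (1 : Matrix ν ν ℝ) + Xbar * 𝔔₀ * X)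
      + ((Xbar * 𝔔₁ * (1 : Matrix ν ν ℝ) + Xbar * 𝔔₀ * X)
        + ((1 : Matrix κ κ ℝ) * 𝔔₂ * (1 : Matrix ν ν ℝ) + (1 : Matrix κ κ ℝ) * 𝔔₁ * X + ((1 : Matrix κ κ ℝ) * 𝔔₁ * X + (1 : Matrix κ κ ℝ) * 𝔔₀ * (X * X)))) = 𝔔'₂ := by
    simpa only [Matrix.one_mul, Matrix.mul_one] using q2
  have j0 : (1 : Matrix ν ν ℝ) * W₀ = W₀ * (1 : Matrix (ρ₂ ⊕ ρ₁) (ρ₂ ⊕ ρ₁) ℝ) := by rw [Matrix.one_mul, Matrix.mul_one]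
  have j1' : -X * W₀ + (1 : Matrix ν ν ℝ) * W₁ = W'₁ * (1 : Matrix (ρ₂ ⊕ ρ₁) (ρ₂ ⊕ ρ₁) ℝ) + W₀ * C₁ := by
    simpa only [Matrix.one_mul, Matrix.mul_one] using j1
  have j2' : X * X * W₀ + (2 : ℝ) • (-X * W₁) + (1 : Matrix ν ν ℝ) * W₂ = W'₂ * (1 : Matrix (ρ₂ ⊕ ρ₁) (ρ₂ ⊕ ρ₁) ℝ) + (2 : ℝ) • (W'₁ * C₁) + W₀ * C₂ := by
    simpa only [Matrix.one_mul, Matrix.mul_one] using j2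
  have hPW₁ : (P * W₀ * (1 : Matrix (ρ₂ ⊕ ρ₁) (ρ₂ ⊕ ρ₁) ℝ)).det ≠ 0 := by rw [Matrix.mul_one]; exact hPW
  have htr : (cgen * cgen).trace ≠ 0 := by rw [trace_cgen_mul_cgen]; norm_num
  exact secondVar_oneShot_nestedStepLaw_transported_graded_of_uni cgen cgen_transpose htr H₀ H₁ H₂ Q₁₀ Q₁₁ Q₁₂ Q₂₀ Q₂₁ Q₂₂ G₀ G₁ G₂ τ₁ τ₂ P W₀ W₁ W₂ Y₀ Y₁ Y₂
    (1 : Matrix ν ν ℝ) X (X * X) (1 : Matrix ν ν ℝ) (-X) (X * X) (1 : Matrix κ κ ℝ) Xbar (Xbar * Xbar) W₀ W'₁ W'₂ (1 : Matrix (ρ₂ ⊕ ρ₁) (ρ₂ ⊕ ρ₁) ℝ) C₁ C₂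
    h𝔎₀ h𝔎₁ h𝔎₂ h𝔔₀ h𝔔₁ h𝔔₂ k0 k1' k2' q0 q1' q2' det_expJet₀_ne_zero det_expJet₀_ne_zero expJet_b0 (expJet_b1 X) (expJet_b2 X)
    (secondVar_expJet X) (secondVar_expJet Xbar) j0 j1' j2' det_expJet₀_ne_zero uC uP' uT h𝔎₀t h𝔎₁t h𝔎₂t a0 a1 a2 b0 b1 b2 hPW hTW hPW
    hΓ hI hL hS hB h1 h2

/-! ## §2 Under the six dead-row letters -/

/-- [folklore] **THE SAME UNDER THE DEAD-ROW LETTERS** (`P·W♯₁ = P·W♯₂ = 0`; `τ₁·W₁ = τ₁·W₂ = 0`, `τ₂·(Q₁₁W₀ + Q₁₀W₁) = 0`, `τ₂·(Q₁₂W₀ + 2•Q₁₁W₁ + Q₁₀W₂) = 0`):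
the graded twin of `NestedStepLawTransportedExp.secondVar_oneShot_nestedStepLaw_expTransported_of_letters` (p319988). -/
theorem secondVar_oneShot_nestedStepLaw_expTransported_graded_of_letters
    (H₀ H₁ H₂ : Matrix ν ν ℝ) (Q₁₀ Q₁₁ Q₁₂ : Matrix μ ν ℝ) (Q₂₀ Q₂₁ Q₂₂ : Matrix κ μ ℝ) (G₀ G₁ G₂ : Matrix μ μ ℝ)
    (τ₁ : Matrix ρ₁ ν ℝ) (τ₂ : Matrix ρ₂ μ ℝ) (P : Matrix (ρ₂ ⊕ ρ₁) ν ℝ) (W₀ W₁ W₂ : Matrix ν (ρ₂ ⊕ ρ₁) ℝ) (Y₀ Y₁ Y₂ : Matrix κ (ρ₂ ⊕ ρ₁) ℝ)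
    -- the transport generators (fields, composite multipliers), the one-shot chart's generator jets and the parameter-transport jets
    (X : Matrix ν ν ℝ) (Xbar : Matrix κ κ ℝ) (W'₁ W'₂ : Matrix ν (ρ₂ ⊕ ρ₁) ℝ) (C₁ C₂ : Matrix (ρ₂ ⊕ ρ₁) (ρ₂ ⊕ ρ₁) ℝ)
    {𝔎₀ 𝔎₁ 𝔎₂ : Matrix ν ν ℝ} {𝔔₀ 𝔔₁ 𝔔₂ : Matrix κ ν ℝ}
    -- GRADED namings of the composite jets of the NESTED chart (as the door p323821)
    (h𝔎₀ : H₀ + Q₁₀ᵀ * G₀ * Q₁₀ = 𝔎₀) (h𝔎₁ : H₁ + (-(Q₁₁ᵀ * G₀ * Q₁₀) + Q₁₀ᵀ * G₁ * Q₁₀ + Q₁₀ᵀ * G₀ * Q₁₁) = 𝔎₁)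
    (h𝔎₂ : H₂ + ((Q₁₂ᵀ * G₀ * Q₁₀ + -(Q₁₁ᵀ * G₁ * Q₁₀) + -(Q₁₁ᵀ * G₀ * Q₁₁)) + (-(Q₁₁ᵀ * G₁ * Q₁₀) + Q₁₀ᵀ * G₂ * Q₁₀ + Q₁₀ᵀ * G₁ * Q₁₁)
            + (-(Q₁₁ᵀ * G₀ * Q₁₁) + Q₁₀ᵀ * G₁ * Q₁₁ + Q₁₀ᵀ * G₀ * Q₁₂)) = 𝔎₂)
    (h𝔔₀ : Q₂₀ * Q₁₀ = 𝔔₀) (h𝔔₁ : Q₂₁ * Q₁₀ + Q₂₀ * Q₁₁ = 𝔔₁) (h𝔔₂ : Q₂₂ * Q₁₀ + Q₂₁ * Q₁₁ + (Q₂₁ * Q₁₁ + Q₂₀ * Q₁₂) = 𝔔₂)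
    -- (T-β-1) GRADED, exponential transport: the one-shot literal's composite jets are the graded `X`-conjugated words, NAMED (words led by `Xᵀ` negative)
    {𝔎'₁ 𝔎'₂ : Matrix ν ν ℝ} {𝔔'₁ 𝔔'₂ : Matrix κ ν ℝ}
    (k1 : -(Xᵀ * 𝔎₀) + 𝔎₁ + 𝔎₀ * X = 𝔎'₁)
    (k2 : (X * X)ᵀ * 𝔎₀ + (-(Xᵀ * 𝔎₁) + -(Xᵀ * 𝔎₀ * X)) + ((-(Xᵀ * 𝔎₁) + -(Xᵀ * 𝔎₀ * X)) + (𝔎₂ + 𝔎₁ * X + (𝔎₁ * X + 𝔎₀ * (X * X)))) = 𝔎'₂)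
    (q1 : Xbar * 𝔔₀ + 𝔔₁ + 𝔔₀ * X = 𝔔'₁)
    (q2 : Xbar * Xbar * 𝔔₀ + (Xbar * 𝔔₁ + Xbar * 𝔔₀ * X) + ((Xbar * 𝔔₁ + Xbar * 𝔔₀ * X) + (𝔔₂ + 𝔔₁ * X + (𝔔₁ * X + 𝔔₀ * (X * X)))) = 𝔔'₂)
    -- (T-β-4) intertwining (inverse field transport `(1, −X, X·X)`; `W♯₀ = W₀`, `C₀ = 1`) and unimodularity of the parameter transport
    (j1 : -X * W₀ + W₁ = W'₁ + W₀ * C₁) (j2 : X * X * W₀ + (2 : ℝ) • (-X * W₁) + W₂ = W'₂ + (2 : ℝ) • (W'₁ * C₁) + W₀ * C₂)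
    (uC : secondVar (1 : Matrix (ρ₂ ⊕ ρ₁) (ρ₂ ⊕ ρ₁) ℝ) C₁ C₂ = 0)
    -- dead rows: the one-shot slice along the one-shot family; the nested slice along the nested family
    (p1 : P * W'₁ = 0) (p2 : P * W'₂ = 0)
    (s1 : τ₁ * W₁ = 0) (s2 : τ₁ * W₂ = 0) (t1 : τ₂ * (Q₁₁ * W₀ + Q₁₀ * W₁) = 0) (t2 : τ₂ * (Q₁₂ * W₀ + (2 : ℝ) • (Q₁₁ * W₁) + Q₁₀ * W₂) = 0)
    -- parities of the composite form jets of the nested chart (the two-sided letters follow)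
    (h𝔎₀t : 𝔎₀ᵀ = 𝔎₀) (h𝔎₁t : 𝔎₁ᵀ = -𝔎₁) (h𝔎₂t : 𝔎₂ᵀ = 𝔎₂)
    -- GRADED one-sided Ward letters of the composite system, NESTED chart (as the door p323821)
    (a0 : 𝔎₀ * W₀ = 𝔔₀ᵀ * Y₀) (a1 : 𝔎₁ * W₀ + 𝔎₀ * W₁ = -(𝔔₁ᵀ * Y₀) + 𝔔₀ᵀ * Y₁)
    (a2 : 𝔎₂ * W₀ + (2 : ℝ) • (𝔎₁ * W₁) + 𝔎₀ * W₂ = 𝔔₂ᵀ * Y₀ + -((2 : ℝ) • (𝔔₁ᵀ * Y₁)) + 𝔔₀ᵀ * Y₂)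
    (b0 : 𝔔₀ * W₀ = 0) (b1 : 𝔔₁ * W₀ + 𝔔₀ * W₁ = 0) (b2 : 𝔔₂ * W₀ + (2 : ℝ) • (𝔔₁ * W₁) + 𝔔₀ * W₂ = 0)
    (hPW : (P * W₀).det ≠ 0) (hTW : (fromRows (τ₂ * Q₁₀) τ₁ * W₀).det ≠ 0)
    {Γ : Matrix ν ν ℝ} {I : Matrix ν (μ ⊕ ρ₁) ℝ} {L : Matrix (μ ⊕ ρ₁) ν ℝ} {S : Matrix (μ ⊕ ρ₁) (μ ⊕ ρ₁) ℝ} {B : Matrix (μ ⊕ ρ₁) ν ℝ}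
    (hΓ : flucCov H₀ (fromRows Q₁₀ τ₁) = Γ) (hI : minOp H₀ (fromRows Q₁₀ τ₁) = I) (hL : minOpL H₀ (fromRows Q₁₀ τ₁) = L) (hS : effForm H₀ (fromRows Q₁₀ τ₁) = S)
    (hB : fromRows Q₁₁ (0 : Matrix ρ₁ ν ℝ) = B)
    (h1 : (kkt H₀ (fromRows Q₁₀ τ₁)).det ≠ 0)
    (h2 : (kkt (S.toBlocks₁₁ + G₀) (fromRows Q₂₀ τ₂)).det ≠ 0) :
    secondVar (kkt 𝔎₀ (fromRows 𝔔₀ P))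
        (fromBlocks 𝔎'₁ (-(fromRows 𝔔'₁ (0 : Matrix (ρ₂ ⊕ ρ₁) ν ℝ))ᵀ) (fromRows 𝔔'₁ (0 : Matrix (ρ₂ ⊕ ρ₁) ν ℝ)) 0)
        (kkt 𝔎'₂ (fromRows 𝔔'₂ (0 : Matrix (ρ₂ ⊕ ρ₁) ν ℝ)))
      = secondVar (kkt H₀ (fromRows Q₁₀ τ₁)) (fromBlocks H₁ (-Bᵀ) B 0) (kkt H₂ (fromRows Q₁₂ (0 : Matrix ρ₁ ν ℝ)))
        + secondVar
            (kkt (S.toBlocks₁₁ + G₀) (fromRows Q₂₀ τ₂))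
            (fromBlocks (((L * H₁ - S * B) * I + L * Bᵀ * S).toBlocks₁₁ + G₁) (-(fromRows Q₂₁ (0 : Matrix ρ₂ μ ℝ))ᵀ)
              (fromRows Q₂₁ (0 : Matrix ρ₂ μ ℝ)) 0)
            (kkt ((((-((L * H₁ - S * B) * Γ - L * Bᵀ * L) * H₁ + L * H₂
                      - (((L * H₁ - S * B) * I + L * Bᵀ * S) * B + S * fromRows Q₁₂ (0 : Matrix ρ₁ ν ℝ))) * I
                    + (L * H₁ - S * B) * (-((Γ * H₁ + I * B) * I + Γ * Bᵀ * S)))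
                  - ((-((L * H₁ - S * B) * Γ - L * Bᵀ * L) * (-Bᵀ) + L * (fromRows Q₁₂ (0 : Matrix ρ₁ ν ℝ))ᵀ) * S
                      + L * (-Bᵀ) * ((L * H₁ - S * B) * I + L * Bᵀ * S))).toBlocks₁₁ + G₂)
              (fromRows Q₂₂ (0 : Matrix ρ₂ μ ℝ))) :=
  secondVar_oneShot_nestedStepLaw_expTransported_graded_of_uni H₀ H₁ H₂ Q₁₀ Q₁₁ Q₁₂ Q₂₀ Q₂₁ Q₂₂ G₀ G₁ G₂ τ₁ τ₂ P W₀ W₁ W₂ Y₀ Y₁ Y₂ X Xbar W'₁ W'₂ C₁ C₂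
    h𝔎₀ h𝔎₁ h𝔎₂ h𝔔₀ h𝔔₁ h𝔔₂ k1 k2 q1 q2 j1 j2 uC (by rw [p1, p2]; exact secondVar_zero_jets _)
    (secondVar_nestedFP_eq_zero τ₁ τ₂ Q₁₀ Q₁₁ Q₁₂ W₀ W₁ W₂ s1 s2 t1 t2) h𝔎₀t h𝔎₁t h𝔎₂t a0 a1 a2 b0 b1 b2 hPW hTW hΓ hI hL hS hB h1 h2

end Summit.QuantumFields.BalabanUV.Beta.FP.NestedStepLawTransportedExpGraded

end
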